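import Summits.CriticalPhenomena.PercolationContinuityZ3.Theorems.PercNearOneGluingNoHeavyLowerTailRKNS
import HarnessLib

/-!
# `NoHeavyLowerTail` (stmt-CriticalPhenomena-4575) — the DOUBLY-REFINED Kozma–Nitzan residual `(RKNS²)_k`:
# `(RKNS²)_k ⟹ EG_k` (sharp event gluing) and `(∀ graphs, (RKNS²) at a worst relay) ⟹ NoHeavyLowerTail`

Support file (new-inequality factory seat `prim-ineq-gen-7`, `--supports stmt-CriticalPhenomena-4575`). No definitions, no sorries.

Setting as in `…NoHeavyLowerTailRKNS` (prover `prim-ineq-prove-4`): `μ = prodBernoulli w` on `Fin n`, relays `A`, observer `o ∉ A`,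
sink `c ∉ A`, `o ≠ c`, designated relay `z ∈ A`; for `∅ ≠ S ⊆ A ∖ {z}`, `R = A ∖ S`,
`N'_S = {S ∪ {o} ↮ R}`, `m_S = μ(N'_S ∩ {c ↔ all S})`, `m_R = μ(N'_S ∩ {c ↔ all R})`, `Z = μ(o ↮ A, z ↮ c)`.
The landed row `(RKNS)_k` bounds both exchange terms with the SAME conditioning event `N'_S` (source set `S ∪ {o}`).
Here the two van den Berg–Häggström–Kahn steps are taken with the natural LARGER separations:
* plus step, source set `S ∪ {o, c}`:  `N⁺_S = {S ∪ {o, c} ↮ R}`,  `T_S ≥ (A⁺_S / P⁺_S) · m_S`,  `A⁺_S = μ(N⁺_S ∩ {o ↔ S})`, `P⁺_S = μ(N⁺_S)`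
  (on `{c ↔ all S}` the events `N'_S` and `N⁺_S` coincide, `RKNS2.plus_inter_eq`);
* minus step, sets `S ∪ {o}` versus `R ∪ {c}`:  `N⁻_S = {S ∪ {o} ↮ R ∪ {c}}`,  `U_S ≤ (A⁻_S / P⁻_S) · m_R`
  (on `{c ↔ all R}` the events `N'_S` and `N⁻_S` coincide, `RKNS2.minus_inter_eq`).
Row `(RKNS²)_k :  Z + Σ_S [(A⁺_S/P⁺_S) m_S − (A⁻_S/P⁻_S) m_R] ≥ 0`.  `eventGluing_of_rkns2_at`: the row gives `μ({o↔A} ∖ {o↔c}) ≤ μ(z ↮ c)`;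
`noHeavyLowerTail_of_rkns2`: the row at a worst relay on every finite weighted graph closes the crux (tree `noHeavyLowerTail_of_eventGluing`).

Why this row (seat census, memo run/shared/lean/prim/prim-ineq-gen-7/FINDING-RKNSK.md): by BHK, `A⁺_S/P⁺_S ≥ A_S/P_S ≥ A⁻_S/P⁻_S`, so `(RKNS²)_k`
is implied by `(RKNS)_k` (formally weaker hypothesis, same conclusion), and it does not collapse on the near-glued hub families where `(RKNS)_k`
wastes all but `e^{-ck}` of the event-gluing margin (k ≤ 200 exact evaluations); 0 violations of either row are known (graphs k ≤ 6, star-like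
multi-class families k ≤ 200, hypergraph laws k ≤ 4).
[cite: KozmaNitzan2024, Theorem 2 (§3.1, pp. 8–9); VandenbergHaggstromKahn2005, Thms. 1.3–1.4 (pp. 6–7)]
-/

namespace Summit.CriticalPhenomena.PercolationContinuityZ3.Theorems

open MeasureTheory Set Literature.Probability.LatticeModels Literature.Probability.Percolation

noncomputable section
open Classical

variable {n : ℕ}

namespace RKNS2

/-- On `{c ↔ all of S}` (`S ≠ ∅`) the separations `{S ∪ {o} ↮ A ∖ S}` and `{S ∪ {o, c} ↮ A ∖ S}` coincide (intersected with any
further event `E`). [folklore] -/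
theorem plus_inter_eq (A S : Finset (Fin n)) (o c : Fin n) (hS : S.Nonempty) (E : Set (BondConfig (Fin n))) :
    {ω : BondConfig (Fin n) | ∀ s ∈ insert o S, ∀ x ∈ A \ S, ¬ (openGraph ω).Reachable s x} ∩
        (E ∩ ⋂ s ∈ S, (openConn s c : Set (BondConfig (Fin n)))) =
      {ω : BondConfig (Fin n) | ∀ s ∈ insert c (insert o S), ∀ x ∈ A \ S, ¬ (openGraph ω).Reachable s x} ∩
        (E ∩ ⋂ s ∈ S, (openConn s c : Set (BondConfig (Fin n)))) := by
  ext ω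
  simp only [mem_inter_iff, mem_setOf_eq, mem_iInter, knThm2_mem_openConn]
  constructor
  · rintro ⟨hN, hE, hall⟩
    refine ⟨fun s hs x hx => ?_, hE, hall⟩
    rcases Finset.mem_insert.1 hs with rfl | hs'
    · intro hcx
      obtain ⟨t, ht⟩ := hS
      exact hN t (Finset.mem_insert_of_mem ht) x hx ((hall t ht).trans hcx)
    · exact hN s hs' x hx
  · rintro ⟨hN, hE, hall⟩
    exact ⟨fun s hs x hx => hN s (Finset.mem_insert_of_mem hs) x hx, hE, hall⟩

/-- On `{c ↔ all of A ∖ S}` (`A ∖ S ≠ ∅`) the separations `{S ∪ {o} ↮ A ∖ S}` and `{S ∪ {o} ↮ (A ∖ S) ∪ {c}}` coincide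
(intersected with any further event `E`). [folklore] -/
theorem minus_inter_eq (A S : Finset (Fin n)) (o c : Fin n) (hR : (A \ S).Nonempty) (E : Set (BondConfig (Fin n))) :
    {ω : BondConfig (Fin n) | ∀ s ∈ insert o S, ∀ x ∈ A \ S, ¬ (openGraph ω).Reachable s x} ∩
        (E ∩ ⋂ x ∈ A \ S, (openConn x c : Set (BondConfig (Fin n)))) =
      {ω : BondConfig (Fin n) | ∀ s ∈ insert o S, ∀ x ∈ insert c (A \ S), ¬ (openGraph ω).Reachable s x} ∩
        (E ∩ ⋂ x ∈ A \ S, (openConn x c : Set (BondConfig (Fin n)))) := by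
  ext ω
  simp only [mem_inter_iff, mem_setOf_eq, mem_iInter, knThm2_mem_openConn]
  constructor
  · rintro ⟨hN, hE, hall⟩
    refine ⟨fun s hs x hx => ?_, hE, hall⟩
    rcases Finset.mem_insert.1 hx with rfl | hx'
    · intro hsc
      obtain ⟨t, ht⟩ := hR
      exact hN s hs t ht (hsc.trans (hall t ht).symm)
    · exact hN s hs x hx'
  · rintro ⟨hN, hE, hall⟩
    exact ⟨fun s hs x hx => hN s hs x (Finset.mem_insert_of_mem hx), hE, hall⟩

/-- From `A⁺ m_S ≤ P⁺ T`, `P⁻ U ≤ A⁻ m_R`, `0 ≤ T ≤ P⁺`, `0 ≤ U ≤ P⁻`: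
`(A⁺/P⁺) m_S − (A⁻/P⁻) m_R ≤ T − U` (with `x / 0 = 0`). [folklore] -/
theorem arith_term2 {Ap Pp Am Pm T U mS mR : ℝ} (hTP : T ≤ Pp) (hUP : U ≤ Pm) (hT : 0 ≤ T) (hU : 0 ≤ U)
    (i1 : Ap * mS ≤ Pp * T) (i2 : Pm * U ≤ Am * mR) : Ap / Pp * mS - Am / Pm * mR ≤ T - U := by
  have h1 : Ap / Pp * mS ≤ T := by
    by_cases hP : Pp = 0
    · rw [hP, div_zero, zero_mul]; exact hT
    · have hPpos : 0 < Pp := lt_of_le_of_ne (hT.trans hTP) (Ne.symm hP)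
      rw [div_mul_eq_mul_div, div_le_iff₀ hPpos]
      linarith
  have h2 : U ≤ Am / Pm * mR := by
    by_cases hP : Pm = 0
    · rw [hP, div_zero, zero_mul]
      rw [hP] at hUP
      exact hUP
    · have hPpos : 0 < Pm := lt_of_le_of_ne (hU.trans hUP) (Ne.symm hP)
      rw [div_mul_eq_mul_div, le_div_iff₀ hPpos]
      linarith
  linarith

/-- For `∅ ≠ S ⊆ A` with `A ∖ S ≠ ∅`, `o, c ∉ A`, `o ≠ c`:
`T_S − U_S ≥ (A⁺_S / P⁺_S) · m_S − (A⁻_S / P⁻_S) · m_R` — BHK Thm 1.3 for the cluster of the set `S ∪ {o, c}` given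
`{S ∪ {o,c} ↮ A∖S}`, and BHK Thm 1.4 for the clusters of `S ∪ {o}` and `(A∖S) ∪ {c}` given their separation (tools = the landed
`stub_bhkSets`, through `knRef_bhkOne/Two`). [cite: VandenbergHaggstromKahn2005, Thms. 1.3–1.4 (pp. 6–7)] -/
theorem term_ge2 (w : Sym2 (Fin n) → unitInterval) (A S : Finset (Fin n)) (o c : Fin n) (ho : o ∉ A) (hc : c ∉ A)
    (hoc : o ≠ c) (hSA : S ⊆ A) (hS : S.Nonempty) (hR : (A \ S).Nonempty) :
    (prodBernoulli w).real
        ({ω : BondConfig (Fin n) | ∀ s ∈ insert c (insert o S), ∀ x ∈ A \ S, ¬ (openGraph ω).Reachable s x} ∩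
          ⋃ s ∈ S, (openConn s o : Set (BondConfig (Fin n)))) /
      (prodBernoulli w).real {ω : BondConfig (Fin n) | ∀ s ∈ insert c (insert o S), ∀ x ∈ A \ S, ¬ (openGraph ω).Reachable s x} *
      (prodBernoulli w).real
          ({ω : BondConfig (Fin n) | ∀ s ∈ insert o S, ∀ x ∈ A \ S, ¬ (openGraph ω).Reachable s x} ∩
            ⋂ s ∈ S, (openConn s c : Set (BondConfig (Fin n)))) -
    (prodBernoulli w).real
        ({ω : BondConfig (Fin n) | ∀ s ∈ insert o S, ∀ x ∈ insert c (A \ S), ¬ (openGraph ω).Reachable s x} ∩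
          ⋃ s ∈ S, (openConn s o : Set (BondConfig (Fin n)))) /
      (prodBernoulli w).real {ω : BondConfig (Fin n) | ∀ s ∈ insert o S, ∀ x ∈ insert c (A \ S), ¬ (openGraph ω).Reachable s x} *
      (prodBernoulli w).real
          ({ω : BondConfig (Fin n) | ∀ s ∈ insert o S, ∀ x ∈ A \ S, ¬ (openGraph ω).Reachable s x} ∩
            ⋂ x ∈ A \ S, (openConn x c : Set (BondConfig (Fin n)))) ≤
    (prodBernoulli w).real
        ({ω : BondConfig (Fin n) | ∀ s ∈ insert o S, ∀ x ∈ A \ S, ¬ (openGraph ω).Reachable s x} ∩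
          ((⋃ s ∈ S, (openConn s o : Set (BondConfig (Fin n)))) ∩ ⋂ s ∈ S, (openConn s c : Set (BondConfig (Fin n))))) -
      (prodBernoulli w).real
        ({ω : BondConfig (Fin n) | ∀ s ∈ insert o S, ∀ x ∈ A \ S, ¬ (openGraph ω).Reachable s x} ∩
          ((⋃ s ∈ S, (openConn s o : Set (BondConfig (Fin n)))) ∩
            ⋂ x ∈ A \ S, (openConn x c : Set (BondConfig (Fin n))))) := by
  -- plus step: BHK Thm 1.3 for the cluster of `S ∪ {o, c}`
  have hOS : S ⊆ insert c (insert o S) := (Finset.subset_insert o S).trans (Finset.subset_insert c _)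
  have hSX : ∀ s ∈ insert c (insert o S), s ∉ (↑(A \ S) : Set (Fin n)) := by
    intro s hs
    rw [Finset.mem_coe, Finset.mem_sdiff]
    rcases Finset.mem_insert.1 hs with rfl | hs
    · exact fun h => hc h.1
    rcases Finset.mem_insert.1 hs with rfl | hsS
    · exact fun h => ho h.1
    · exact fun h => h.2 hsS
  have i1 := knRef_bhkOne stub_bhkSets.1 w (insert c (insert o S)) S hOS (↑(A \ S) : Set (Fin n)) o c hSX
  have hset : {ω : BondConfig (Fin n) | ∀ s ∈ insert c (insert o S), ∀ x ∈ (↑(A \ S) : Set (Fin n)),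
      ¬ (openGraph ω).Reachable s x} =
      {ω : BondConfig (Fin n) | ∀ s ∈ insert c (insert o S), ∀ x ∈ A \ S, ¬ (openGraph ω).Reachable s x} := by
    ext ω; simp only [mem_setOf_eq, Finset.mem_coe]
  rw [hset] at i1
  -- rewrite `m_S` and `T_S` to the `N⁺` conditioning
  have e1 := plus_inter_eq A S o c hS (Set.univ : Set (BondConfig (Fin n)))
  have e1' := plus_inter_eq A S o c hS (⋃ s ∈ S, (openConn s o : Set (BondConfig (Fin n))))
  simp only [Set.univ_inter] at e1
  -- minus step: BHK Thm 1.4 for the clusters of `S ∪ {o}` and `(A ∖ S) ∪ {c}`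
  have hdisj : Disjoint (insert o S) (insert c (A \ S)) := by
    rw [Finset.disjoint_left]
    intro s hs hs'
    rcases Finset.mem_insert.1 hs with rfl | hsS
    · rcases Finset.mem_insert.1 hs' with h | h
      · exact hoc h
      · exact ho (Finset.mem_sdiff.1 h).1
    · rcases Finset.mem_insert.1 hs' with h | h
      · exact hc (h ▸ hSA hsS)
      · exact (Finset.mem_sdiff.1 h).2 hsS
  have i2 := knRef_bhkTwo stub_bhkSets.2 w (insert o S) (insert c (A \ S)) S (A \ S) (Finset.subset_insert o S)
    (Finset.subset_insert c _) o c hdisj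
  have e2 := minus_inter_eq A S o c hR (Set.univ : Set (BondConfig (Fin n)))
  have e2' := minus_inter_eq A S o c hR (⋃ s ∈ S, (openConn s o : Set (BondConfig (Fin n))))
  simp only [Set.univ_inter] at e2
  rw [e1, e1', e2, e2']
  exact arith_term2
    (measureReal_mono (h₂ := measure_ne_top _ _) inter_subset_left)
    (measureReal_mono (h₂ := measure_ne_top _ _) inter_subset_left)
    measureReal_nonneg measureReal_nonneg i1 i2

/-- **`X ≥ Σ_S [(A⁺_S/P⁺_S) m_S − (A⁻_S/P⁻_S) m_R]`**: the doubly-refined `k`-relay Kozma–Nitzan exchange at the designated relay `z`.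
[cite: KozmaNitzan2024, Theorem 2 (§3.1, pp. 8–9); VandenbergHaggstromKahn2005, Thms. 1.3–1.4 (pp. 6–7)] -/
theorem X_ge_sum2 (w : Sym2 (Fin n) → unitInterval) (A : Finset (Fin n)) (o c z : Fin n) (ho : o ∉ A) (hc : c ∉ A)
    (hoc : o ≠ c) (hz : z ∈ A) :
    ∑ S ∈ (A.erase z).powerset.filter (fun S => S.Nonempty),
      ((prodBernoulli w).real
          ({ω : BondConfig (Fin n) | ∀ s ∈ insert c (insert o S), ∀ x ∈ A \ S, ¬ (openGraph ω).Reachable s x} ∩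
            ⋃ s ∈ S, (openConn s o : Set (BondConfig (Fin n)))) /
        (prodBernoulli w).real {ω : BondConfig (Fin n) | ∀ s ∈ insert c (insert o S), ∀ x ∈ A \ S, ¬ (openGraph ω).Reachable s x} *
        (prodBernoulli w).real
            ({ω : BondConfig (Fin n) | ∀ s ∈ insert o S, ∀ x ∈ A \ S, ¬ (openGraph ω).Reachable s x} ∩
              ⋂ s ∈ S, (openConn s c : Set (BondConfig (Fin n)))) -
      (prodBernoulli w).real
          ({ω : BondConfig (Fin n) | ∀ s ∈ insert o S, ∀ x ∈ insert c (A \ S), ¬ (openGraph ω).Reachable s x} ∩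
            ⋃ s ∈ S, (openConn s o : Set (BondConfig (Fin n)))) /
        (prodBernoulli w).real {ω : BondConfig (Fin n) | ∀ s ∈ insert o S, ∀ x ∈ insert c (A \ S), ¬ (openGraph ω).Reachable s x} *
        (prodBernoulli w).real
            ({ω : BondConfig (Fin n) | ∀ s ∈ insert o S, ∀ x ∈ A \ S, ¬ (openGraph ω).Reachable s x} ∩
              ⋂ x ∈ A \ S, (openConn x c : Set (BondConfig (Fin n))))) ≤
    (prodBernoulli w).real ((⋃ a ∈ A, (openConn o a : Set (BondConfig (Fin n)))) ∩ openConn o c) -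
      (prodBernoulli w).real ((⋃ a ∈ A, (openConn o a : Set (BondConfig (Fin n)))) ∩ openConn z c) := by
  have h1 := RKNS.pos_ge w A o c z hz
  have h2 := RKNS.neg_le w A o c z ho
  have h3 : ∑ S ∈ (A.erase z).powerset.filter (fun S => S.Nonempty),
      ((prodBernoulli w).real
          ({ω : BondConfig (Fin n) | ∀ s ∈ insert c (insert o S), ∀ x ∈ A \ S, ¬ (openGraph ω).Reachable s x} ∩
            ⋃ s ∈ S, (openConn s o : Set (BondConfig (Fin n)))) /
        (prodBernoulli w).real {ω : BondConfig (Fin n) | ∀ s ∈ insert c (insert o S), ∀ x ∈ A \ S, ¬ (openGraph ω).Reachable s x} *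
        (prodBernoulli w).real
            ({ω : BondConfig (Fin n) | ∀ s ∈ insert o S, ∀ x ∈ A \ S, ¬ (openGraph ω).Reachable s x} ∩
              ⋂ s ∈ S, (openConn s c : Set (BondConfig (Fin n)))) -
      (prodBernoulli w).real
          ({ω : BondConfig (Fin n) | ∀ s ∈ insert o S, ∀ x ∈ insert c (A \ S), ¬ (openGraph ω).Reachable s x} ∩
            ⋃ s ∈ S, (openConn s o : Set (BondConfig (Fin n)))) /
        (prodBernoulli w).real {ω : BondConfig (Fin n) | ∀ s ∈ insert o S, ∀ x ∈ insert c (A \ S), ¬ (openGraph ω).Reachable s x} *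
        (prodBernoulli w).real
            ({ω : BondConfig (Fin n) | ∀ s ∈ insert o S, ∀ x ∈ A \ S, ¬ (openGraph ω).Reachable s x} ∩
              ⋂ x ∈ A \ S, (openConn x c : Set (BondConfig (Fin n))))) ≤
      ∑ S ∈ (A.erase z).powerset.filter (fun S => S.Nonempty),
        ((prodBernoulli w).real
          ({ω : BondConfig (Fin n) | ∀ s ∈ insert o S, ∀ x ∈ A \ S, ¬ (openGraph ω).Reachable s x} ∩
            ((⋃ s ∈ S, (openConn s o : Set (BondConfig (Fin n)))) ∩ ⋂ s ∈ S, (openConn s c : Set (BondConfig (Fin n))))) -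
        (prodBernoulli w).real
          ({ω : BondConfig (Fin n) | ∀ s ∈ insert o S, ∀ x ∈ A \ S, ¬ (openGraph ω).Reachable s x} ∩
            ((⋃ s ∈ S, (openConn s o : Set (BondConfig (Fin n)))) ∩
              ⋂ x ∈ A \ S, (openConn x c : Set (BondConfig (Fin n)))))) := by
    refine Finset.sum_le_sum fun S hSm => ?_
    rw [Finset.mem_filter, Finset.mem_powerset] at hSm
    have hSA : S ⊆ A := hSm.1.trans (Finset.erase_subset z A)
    have hR : (A \ S).Nonempty := ⟨z, Finset.mem_sdiff.2 ⟨hz, fun hzS => by simpa using hSm.1 hzS⟩⟩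
    exact term_ge2 w A S o c ho hc hoc hSA hSm.2 hR
  rw [Finset.sum_sub_distrib] at h3
  rw [Finset.sum_sub_distrib] at h3
  rw [Finset.sum_sub_distrib]
  linarith

end RKNS2

open RKNS2

/-- **`(RKNS²)_k ⟹ EG_k` at the designated relay.**  For `o, c ∉ A`, `o ≠ c`, `z ∈ A`: if the doubly-refined residual row
`Σ_{∅≠S⊆A∖z} [(A⁺_S/P⁺_S)·m_S − (A⁻_S/P⁻_S)·m_R] + μ(o↮A, z↮c) ≥ 0` holds (notation in the module docstring), then
`μ({o↔A} ∖ {o↔c}) ≤ μ(z ↮ c)`. [this file] -/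
theorem eventGluing_of_rkns2_at (w : Sym2 (Fin n) → unitInterval) (A : Finset (Fin n)) (o c z : Fin n)
    (ho : o ∉ A) (hc : c ∉ A) (hoc : o ≠ c) (hz : z ∈ A)
    (hR : 0 ≤ ∑ S ∈ (A.erase z).powerset.filter (fun S => S.Nonempty),
      ((prodBernoulli w).real
          ({ω : BondConfig (Fin n) | ∀ s ∈ insert c (insert o S), ∀ x ∈ A \ S, ¬ (openGraph ω).Reachable s x} ∩
            ⋃ s ∈ S, (openConn s o : Set (BondConfig (Fin n)))) /
        (prodBernoulli w).real {ω : BondConfig (Fin n) | ∀ s ∈ insert c (insert o S), ∀ x ∈ A \ S, ¬ (openGraph ω).Reachable s x} *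
        (prodBernoulli w).real
            ({ω : BondConfig (Fin n) | ∀ s ∈ insert o S, ∀ x ∈ A \ S, ¬ (openGraph ω).Reachable s x} ∩
              ⋂ s ∈ S, (openConn s c : Set (BondConfig (Fin n)))) -
      (prodBernoulli w).real
          ({ω : BondConfig (Fin n) | ∀ s ∈ insert o S, ∀ x ∈ insert c (A \ S), ¬ (openGraph ω).Reachable s x} ∩
            ⋃ s ∈ S, (openConn s o : Set (BondConfig (Fin n)))) /
        (prodBernoulli w).real {ω : BondConfig (Fin n) | ∀ s ∈ insert o S, ∀ x ∈ insert c (A \ S), ¬ (openGraph ω).Reachable s x} *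
        (prodBernoulli w).real
            ({ω : BondConfig (Fin n) | ∀ s ∈ insert o S, ∀ x ∈ A \ S, ¬ (openGraph ω).Reachable s x} ∩
              ⋂ x ∈ A \ S, (openConn x c : Set (BondConfig (Fin n))))) +
      (prodBernoulli w).real ((⋃ a ∈ A, (openConn o a : Set (BondConfig (Fin n))))ᶜ ∩ (openConn z c)ᶜ)) :
    (prodBernoulli w).real ((⋃ a ∈ A, (openConn o a : Set (BondConfig (Fin n)))) \ openConn o c) ≤
      (prodBernoulli w).real ((openConn z c)ᶜ : Set (BondConfig (Fin n))) := by
  have hX := X_ge_sum2 w A o c z ho hc hoc hz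
  have hm : ∀ s : Set (BondConfig (Fin n)), MeasurableSet s := fun _ => MeasurableSet.of_discrete
  have h1 := measureReal_inter_add_sdiff (μ := prodBernoulli w)
    (s := ⋃ a ∈ A, (openConn o a : Set (BondConfig (Fin n)))) (hm (openConn o c)) (h := measure_ne_top _ _)
  have h2 := measureReal_inter_add_sdiff (μ := prodBernoulli w)
    (s := ⋃ a ∈ A, (openConn o a : Set (BondConfig (Fin n)))) (hm (openConn z c)) (h := measure_ne_top _ _)
  have h3 := measureReal_inter_add_sdiff (μ := prodBernoulli w)
    (s := ((openConn z c)ᶜ : Set (BondConfig (Fin n)))) (hm (⋃ a ∈ A, (openConn o a : Set (BondConfig (Fin n)))))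
    (h := measure_ne_top _ _)
  have e1 : ((openConn z c)ᶜ : Set (BondConfig (Fin n))) ∩ (⋃ a ∈ A, (openConn o a : Set (BondConfig (Fin n)))) =
      (⋃ a ∈ A, (openConn o a : Set (BondConfig (Fin n)))) \ openConn z c := by
    ext ω; simp only [mem_inter_iff, mem_compl_iff, mem_sdiff]; tauto
  have e2 : ((openConn z c)ᶜ : Set (BondConfig (Fin n))) \ (⋃ a ∈ A, (openConn o a : Set (BondConfig (Fin n)))) =
      (⋃ a ∈ A, (openConn o a : Set (BondConfig (Fin n))))ᶜ ∩ (openConn z c)ᶜ := by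
    ext ω; simp only [mem_inter_iff, mem_compl_iff, mem_sdiff]; tauto
  rw [e1, e2] at h3
  linarith

/-- **`(RKNS²)` at a worst relay on every finite weighted graph ⟹ sharp event gluing for every `k` ⟹ `NoHeavyLowerTail`**
(stmt-CriticalPhenomena-4575), through the landed chain `noHeavyLowerTail_of_eventGluing`.  The hypothesis is the doubly-refined
residual row for all `n, w`, relay sets `A`, observer `o ∉ A`, sink `c ∉ A`, `o ≠ c`, and designated relay `z ∈ A` that is worst
(`μ(z ↔ c) ≤ μ(a ↔ c)` for all `a ∈ A`).  By BHK monotonicity of the conditional attachment probabilities (`A⁺/P⁺ ≥ A/P ≥ A⁻/P⁻`)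
this hypothesis is implied by the hypothesis of `noHeavyLowerTail_of_rkns`. [this file] -/
theorem noHeavyLowerTail_of_rkns2
    (hR : ∀ (n : ℕ) (w : Sym2 (Fin n) → unitInterval) (A : Finset (Fin n)) (o c z : Fin n),
      o ∉ A → c ∉ A → o ≠ c → z ∈ A →
      (∀ a ∈ A, (prodBernoulli w).real (openConn z c) ≤ (prodBernoulli w).real (openConn a c)) →
      0 ≤ ∑ S ∈ (A.erase z).powerset.filter (fun S => S.Nonempty),
        ((prodBernoulli w).real
            ({ω : BondConfig (Fin n) | ∀ s ∈ insert c (insert o S), ∀ x ∈ A \ S, ¬ (openGraph ω).Reachable s x} ∩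
              ⋃ s ∈ S, (openConn s o : Set (BondConfig (Fin n)))) /
          (prodBernoulli w).real {ω : BondConfig (Fin n) | ∀ s ∈ insert c (insert o S), ∀ x ∈ A \ S, ¬ (openGraph ω).Reachable s x} *
          (prodBernoulli w).real
              ({ω : BondConfig (Fin n) | ∀ s ∈ insert o S, ∀ x ∈ A \ S, ¬ (openGraph ω).Reachable s x} ∩
                ⋂ s ∈ S, (openConn s c : Set (BondConfig (Fin n)))) -
        (prodBernoulli w).real
            ({ω : BondConfig (Fin n) | ∀ s ∈ insert o S, ∀ x ∈ insert c (A \ S), ¬ (openGraph ω).Reachable s x} ∩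
              ⋃ s ∈ S, (openConn s o : Set (BondConfig (Fin n)))) /
          (prodBernoulli w).real {ω : BondConfig (Fin n) | ∀ s ∈ insert o S, ∀ x ∈ insert c (A \ S), ¬ (openGraph ω).Reachable s x} *
          (prodBernoulli w).real
              ({ω : BondConfig (Fin n) | ∀ s ∈ insert o S, ∀ x ∈ A \ S, ¬ (openGraph ω).Reachable s x} ∩
                ⋂ x ∈ A \ S, (openConn x c : Set (BondConfig (Fin n))))) +
        (prodBernoulli w).real ((⋃ a ∈ A, (openConn o a : Set (BondConfig (Fin n))))ᶜ ∩ (openConn z c)ᶜ)) :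
    Summit.CriticalPhenomena.PercolationContinuityZ3.Theses.PercNearOneGluing.NoHeavyLowerTail := by
  apply noHeavyLowerTail_of_eventGluing
  intro n w A o c s hs hcut
  by_cases hoc : o = c
  · subst hoc
    have hempty : ((openConn o o : Set (BondConfig (Fin n)))ᶜ ∩ ⋃ a ∈ A, openConn o a) = ∅ := by
      ext ω
      simp only [mem_inter_iff, mem_compl_iff, mem_empty_iff_false, iff_false, not_and]
      intro h; exact absurd (show ω ∈ (openConn o o : Set (BondConfig (Fin _))) from SimpleGraph.Reachable.refl o) h
    rw [hempty, measureReal_empty]; exact hs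
  by_cases hoA : o ∈ A
  · calc (prodBernoulli w).real ((openConn o c : Set (BondConfig (Fin n)))ᶜ ∩ ⋃ a ∈ A, openConn o a)
        ≤ (prodBernoulli w).real ((openConn o c : Set (BondConfig (Fin n)))ᶜ) :=
          measureReal_mono (h₂ := measure_ne_top _ _) inter_subset_left
      _ ≤ s := hcut o hoA
  set A' : Finset (Fin n) := A.erase c with hA'
  have hsub : ((openConn o c : Set (BondConfig (Fin n)))ᶜ ∩ ⋃ a ∈ A, openConn o a) ⊆
      (⋃ a ∈ A', (openConn o a : Set (BondConfig (Fin n)))) \ openConn o c := by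
    rintro ω ⟨hoc', hU⟩
    simp only [mem_iUnion, exists_prop] at hU
    obtain ⟨a, haA, hoa⟩ := hU
    refine ⟨?_, hoc'⟩
    simp only [mem_iUnion, exists_prop]
    refine ⟨a, ?_, hoa⟩
    rw [hA', Finset.mem_erase]
    refine ⟨?_, haA⟩
    rintro rfl; exact hoc' hoa
  refine (measureReal_mono (h₂ := measure_ne_top _ _) hsub).trans ?_
  by_cases hne : A'.Nonempty
  swap
  · rw [Finset.not_nonempty_iff_eq_empty] at hne
    have hempty : ((⋃ a ∈ A', (openConn o a : Set (BondConfig (Fin n)))) \ openConn o c) = ∅ := by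
      rw [hne]; simp
    rw [hempty, measureReal_empty]; exact hs
  obtain ⟨z, hzA', hzmin⟩ := Finset.exists_min_image A' (fun a => (prodBernoulli w).real (openConn a c)) hne
  have hoA' : o ∉ A' := fun h => hoA (Finset.mem_of_mem_erase h)
  have hcA' : c ∉ A' := by rw [hA']; exact Finset.notMem_erase c A
  have hEG := eventGluing_of_rkns2_at w A' o c z hoA' hcA' hoc hzA' (hR n w A' o c z hoA' hcA' hoc hzA' hzmin)
  exact hEG.trans (hcut z (Finset.mem_of_mem_erase hzA'))

end

end Summit.CriticalPhenomena.PercolationContinuityZ3.Theorems
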